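/- Fleet lead `ym-wcr-19456-p1` (seat g2), route `WeakCouplingRates`, crux `ColdBoxTwoPointFloorW` (stmt-QuantumFields-19608). -/
-- tree-module: Summits.QuantumFields.YangMills.Theorems.WeakCouplingRatesColdBoxPlaqChart
import Summits.QuantumFields.YangMills.Theorems.WeakCouplingRatesColdBoxOneScaleDefs
import Summits.QuantumFields.YangMills.Theorems.WeakCouplingRatesColdBoxChartPlaquette

/-!
# Crux `ColdBoxTwoPointFloorW`, stub `stub_boxGaussianDomination`, brick R3: plaquettes of the CHART configuration —
# holonomy = projected quaternion product, Wilson cost = squared linear circulation up to `362·m³`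

For free-link chart data `w` (all links of `chartCfg w` are gnomonic chart points `P(1, v_e)`, `v = extZero w`), read through the
datum-agnostic per-plaquette linearisation of `…ColdBoxChartPlaquette` (seat ym-spine-20043-p1, `abs_plaqCostAt_gnomonic_sub_sum_sq_le`):
* `plaqCostAt_eq_two_sub_trace` — the Wilson cost `plaqCostAt ρ x i j U` (`ρ` = fundamental `SU(2)`) is `2 − Re tr U_p`;
* **`abs_plaqCostAt_chartCfg_sub_le`** — if every link has `|v_e| ≤ m ≤ ¼` then
  `|plaqCostAt ρ x i j (chartCfg w) − Σ_k sCirc(v^k)(x,i,j)²| ≤ 362·m³` (cubic remainder `abs_plaquetteCost_sub_sq_norm_le`, p447229), i.e. per colour triple `t` (`w = unscaleT β H t`, `sCirc_extZero_unscaleT`):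
  **`abs_beta_mul_plaqCostAt_cfgT_sub_qObs_le`** — `|β·cost_p(cfgT β H t) − qObs H p t| ≤ 362·β·m³`;
* `plaqCostAt_nonneg`, `linkCost_chartCfg_eq` / `sum_sq_extZero_le_two_mul_linkCost` — single links: cost `= 2 − 2/√(1+|v_e|²)`, and
  `|v_e|² ≤ 2·cost` when the link cost is `≤ ½`.
No sorry; no new definition; standard axioms.  NOT a claim about the mass gap.
-/

set_option autoImplicit false

noncomputable section

open MeasureTheory Finset Quaternion
open Literature.Probability.LatticeModels (Site)
open Literature.MathematicalPhysics.QuantumLattice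
open Literature.MathematicalPhysics.QuantumFieldTheory
open Literature.MathematicalPhysics.QuantumFieldTheory.LatticeMaxwell
open Literature.MathematicalPhysics.QuantumFieldTheory.AxialGauge

namespace Summit.QuantumFields.YangMills.Theorems.WeakCouplingRates

variable {H : ℕ}

/-! ## Plaquettes of the chart configuration -/

/-- The Wilson cost of the fundamental `SU(2)` plaquette is `2 − Re tr U_p`. -/
theorem plaqCostAt_eq_two_sub_trace (x : Site 4) (i j : Fin 4) (U : LGConfig 4 (Matrix.specialUnitaryGroup (Fin 2) ℂ)) :
    plaqCostAt (fundamentalRep (Fin 2)) x i j U =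
      2 - (((plaquetteHolonomyZd U x i j : Matrix.specialUnitaryGroup (Fin 2) ℂ) : Matrix (Fin 2) (Fin 2) ℂ).trace).re := by
  simp [plaqCostAt, plaquetteObs, fundamentalRep_apply]

/-- **Cubic Taylor remainder for the plaquettes of the chart configuration**: if every link has `Σ_k v_e,k² ≤ m²` with
`0 ≤ m ≤ ¼`, then `|plaqCostAt ρ x i j (chartCfg w) − Σ_k sCirc(v^k)(x,i,j)²| ≤ 362·m³`. -/
theorem abs_plaqCostAt_chartCfg_sub_le (w : ColdFreeIdx H → (Fin 3 → ℝ)) {m : ℝ} (hm0 : 0 ≤ m) (hm : m ≤ 1 / 4)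
    (hw : ∀ e, ∑ k, (extZero w e k) ^ 2 ≤ m ^ 2) (x : Site 4) (i j : Fin 4) :
    |plaqCostAt (fundamentalRep (Fin 2)) x i j (chartCfg w) - ∑ k, (sCirc (fun e => extZero w e k) (x, i, j)) ^ 2| ≤
      362 * m ^ 3 :=
  abs_plaqCostAt_gnomonic_sub_sum_sq_le_of_forall (extZero w) hm0 hm hw x i j

/-- **Per colour triple**: with `w = unscaleT β H t` and all links `Σ_k w_e,k² ≤ m²` (`0 ≤ m ≤ ¼`, `β > 0`), for every plaquette
`|β · plaqCostAt ρ x i j (cfgT β H t) − qObs H (x,i,j) t| ≤ 362·β·m³` — the quadratic (Gaussian) surrogate of `β·cost`. -/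
theorem abs_beta_mul_plaqCostAt_cfgT_sub_qObs_le {β : ℝ} (hβ : 0 < β) (t : TSpace H) {m : ℝ} (hm0 : 0 ≤ m) (hm : m ≤ 1 / 4)
    (hw : ∀ e, ∑ k, (extZero (unscaleT H β t) e k) ^ 2 ≤ m ^ 2) (x : Site 4) (i j : Fin 4) :
    |β * plaqCostAt (fundamentalRep (Fin 2)) x i j (cfgT H β t) - qObs H (x, i, j) t| ≤ 362 * β * m ^ 3 := by
  have key := abs_plaqCostAt_chartCfg_sub_le (unscaleT H β t) hm0 hm hw x i j
  have hq : β * ∑ k, (sCirc (fun e => extZero (unscaleT H β t) e k) (x, i, j)) ^ 2 = qObs H (x, i, j) t := by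
    simp only [sCirc_extZero_unscaleT, div_pow, Real.sq_sqrt (by linarith : (0 : ℝ) ≤ 2 * β), qObs]
    rw [Finset.mul_sum, Finset.mul_sum]
    refine Finset.sum_congr rfl fun k _ => ?_
    field_simp
  rw [← hq, cfgT, ← mul_sub, abs_mul, abs_of_pos hβ]
  calc β * |_| ≤ β * (362 * m ^ 3) := mul_le_mul_of_nonneg_left key hβ.le
    _ = 362 * β * m ^ 3 := by ring

/-! ## Single links of the chart configuration -/

/-- Plaquette costs are nonnegative for `SU(2)` (`Re tr U ≤ 2`). -/
theorem plaqCostAt_nonneg (x : Site 4) (i j : Fin 4) (U : LGConfig 4 (Matrix.specialUnitaryGroup (Fin 2) ℂ)) :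
    0 ≤ plaqCostAt (fundamentalRep (Fin 2)) x i j U := by
  have h := abs_plaquetteObs_le_holds (G := (Matrix.specialUnitaryGroup (Fin 2) ℂ)) (fundamentalRep (Fin 2))
    fundamentalRep_mem_unitaryGroup x i j U
  simp only [plaqCostAt, Nat.cast_ofNat] at h ⊢
  have := (abs_le.1 h).2
  linarith

/-- The single-link Wilson cost of a chart link: `2 − Re tr (chartCfg w e) = 2 − 2/√(1 + Σ_k v_e,k²)`. -/
theorem linkCost_chartCfg_eq (w : ColdFreeIdx H → (Fin 3 → ℝ)) (e : Literature.MathematicalPhysics.QuantumLattice.ZdEdge 4) :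
    2 - (((chartCfg w e : Matrix.specialUnitaryGroup (Fin 2) ℂ) : Matrix (Fin 2) (Fin 2) ℂ).trace).re =
      2 - 2 / Real.sqrt (1 + ∑ k, extZero w e k ^ 2) := by
  rw [chartCfg, gnomonicChart, two_sub_trace_re_gnomonic]

/-- **Chart coordinates are controlled by the link cost**: if `2 − Re tr (chartCfg w e) ≤ c ≤ ½` then `Σ_k v_e,k² ≤ 2c`. -/
theorem sum_sq_extZero_le_two_mul_linkCost (w : ColdFreeIdx H → (Fin 3 → ℝ)) (e : Literature.MathematicalPhysics.QuantumLattice.ZdEdge 4)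
    {c : ℝ} (hc : c ≤ 1 / 2)
    (h : 2 - (((chartCfg w e : Matrix.specialUnitaryGroup (Fin 2) ℂ) : Matrix (Fin 2) (Fin 2) ℂ).trace).re ≤ c) :
    ∑ k, extZero w e k ^ 2 ≤ 2 * c := by
  have h' : 2 - (((quatToSU2 (gnomonicQuat (extZero w e)) : Matrix.specialUnitaryGroup (Fin 2) ℂ) :
      Matrix (Fin 2) (Fin 2) ℂ).trace).re ≤ 1 / 2 := h.trans hc
  have key := sum_sq_le_two_mul_cost h'
  have h2 : 2 - (((quatToSU2 (gnomonicQuat (extZero w e)) : Matrix.specialUnitaryGroup (Fin 2) ℂ) :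
      Matrix (Fin 2) (Fin 2) ℂ).trace).re ≤ c := h
  linarith

/-- Links of the chart configuration are in the upper hemisphere (`Re tr > 0`). -/
theorem chartCfg_mem_upperHemisphere (w : ColdFreeIdx H → (Fin 3 → ℝ)) (e : Literature.MathematicalPhysics.QuantumLattice.ZdEdge 4) :
    chartCfg w e ∈ upperHemisphere :=
  gnomonicChart_mem_upper _

end Summit.QuantumFields.YangMills.Theorems.WeakCouplingRates

end
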